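import Summits.CriticalPhenomena.PercolationContinuityZ3.Theorems.Transplant.PlanarSkeletonFrmFromDefs
import Summits.CriticalPhenomena.PercolationContinuityZ3.Theorems.Transplant.SkelFrmFromBChoiceRootPrefix
import Summits.CriticalPhenomena.PercolationContinuityZ3.Theorems.Transplant.SkelFrmBChoiceRootPrefix
import Summits.CriticalPhenomena.PercolationContinuityZ3.Theorems.Transplant.SkelFrmFromBChoiceRootLanding2
import Summits.CriticalPhenomena.PercolationContinuityZ3.Theorems.Transplant.SkelFrmBChoiceRootLanding2
import Summits.CriticalPhenomena.PercolationContinuityZ3.Theorems.Transplant.SkelFrmFromBChoiceRootRunY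
import Summits.CriticalPhenomena.PercolationContinuityZ3.Theorems.Transplant.SkelFrmBChoiceRootRunY
import Summits.CriticalPhenomena.PercolationContinuityZ3.Theorems.Transplant.SkelPhiRootCrossLinkY
import HarnessLib
import Summits.CriticalPhenomena.PercolationContinuityZ3.Theorems.Transplant.SkelFrmBChoiceRootCrossY
/-!
# U-WAVE PORT (RULING D-U, lead g21 2026-08-26; WAVE-U-MANIFEST v3.0 row «SkelFrmBChoiceRootCrossY» ↦ «SkelFrmFromBChoiceRootCrossY») of the tree module
# `Transplant/SkelFrmBChoiceRootCrossY` onto the carrier `PlanarSkeletonFrmFrom` (frames only, cylinders connected from width `ℓ₀` on)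

ORIGINAL TITLE: N2 (frames-only node `SamePDropOfSkeletonFrm₁`, OPEN), (R) column SECOND axis — **THE SECOND CROSS LINK `hx₂` DISCHARGED** at the values of (R-46)/(R-47):

builds on p205010 (kernel theorem, internal audit signed; external expert review pending) — nothing in this file uses p205010; NOTHING is claimed about the
OPEN node U `SamePDropOfSkeletonFrmFrom₁` (nor U_s / the end state).  Lane `prim-bschramm`, seat `prim-hp-8 gen 53 (U-wave port pen, family P-hp8; tool of record = p3-g26 port_u.py)`; helper file
(`--supports stmt-CriticalPhenomena-4575 --as helper`).  PORT RULES r1–r4 of RULING D-U: declaration order and proof texts are those of the original,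
byte-identical except (i) the carrier token `PlanarSkeletonFrm ↦ PlanarSkeletonFrmFrom` (binders, `namespace`/`end` lines, qualified names of twinned
declarations), (ii) carrier-FREE declarations of the original (φ-level `Skelφ…` blocks and namespace-only arithmetic residents) are NOT re-declared —
this file imports the original and `export`s the twin-free residents (POLICY T / treatment (m1)); residents whose statement mentions a twinned
constant are copied, (iii) every carrier-binding declaration keeps its explicit binder `(Φ : PlanarSkeletonFrmFrom G)` in its own signature (r2).  Docstrings and citations are the original's.  Manifest row idx 163 (level 18; flags verbatim); filed by the hp-8 lineage under RULING M-11 (family P-hp8).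
-/

noncomputable section

open scoped Classical

namespace Summit.CriticalPhenomena.PercolationContinuityZ3.Theorems.Transplant

namespace PlanarSkeletonFrmFrom

namespace NegB

open Literature.Probability.Percolation Literature.Probability.LatticeModels SimpleGraph
open SkelConc (Consts)
open ChainPlanar (ScheduleNP)
open Skelφ (shearUnit kgSL kgSLY kgP KGRows KGYRows kgFar kgX kgM₁ kgM₂ kgCtr2 kgHw2)
open Neg

namespace KS

section CrossY

variable (κ : Consts) {V : Type} [DecidableEq V] [Countable V] {G : SimpleGraph V} [G.LocallyFinite] (Φ : PlanarSkeletonFrmFrom G) (t : V) (p : unitInterval)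
  (D : Skelφ.StepI.DataNS V) (mk g f qxY WxY : ℕ)

/-- **THE FOUR NUMERIC ROWS OF THE SECOND CROSS LINK** (`hx0`, `hx1`, `hr₁`, `hr₂` of p358057) at the prefix's arrival box `[kgLastLo 30, kgLastHi 30]`,
`X₁₂ := X2R − X1`, `S₁₂ := (n_L·Y2R − h_L·X2R) − (n_L·Y1s − h_L·X1) ∈ (−n_L, n_L)`. [this work] -/
theorem hx₂_rows_R (κ : Consts) {V : Type} [DecidableEq V] [Countable V] {G : SimpleGraph V} [G.LocallyFinite] (Φ : PlanarSkeletonFrmFrom G) (t : V) (p : unitInterval) (D : Skelφ.StepI.DataNS V) (mk : ℕ) (g : ℕ) (f : ℕ) (qxY : ℕ) (WxY : ℕ) (hN : EqNumL κ Φ t p D g f) (hg : gFloorKG κ Φ t p D mk ≤ g) (hg2 : 40 * Neg.K κ * KS0.R'0 κ Φ t p D mk ≤ g)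
    (hf : KS.fxR0 κ Φ t p D mk ≤ f) (hWxY : KS.Rs t D mk + 34 * nL κ Φ t p D g f + 29 * KS0.R'0 κ Φ t p D mk + 2 ≤ WxY)
    (hWx45 : 45 * nL κ Φ t p D g f ≤ WxY) (hq3 : 3 * (kgSL (nL κ Φ t p D g f) (ℓL κ Φ t p D g f) (hL κ Φ t p D g f)) ≤ (qxY : ℤ)) :
    -(((((nL κ Φ t p D g f) + (vL κ Φ t p D g f)).toNat + (kgWY κ Φ t p D g f (KS.WxYR κ Φ t p D mk g f WxY)) : ℕ)) : ℤ) ≤ ((kgRows0_of κ Φ t p D g f mk 0 0 hN hg).kgLastLo 30) 0 - ((((KS.X2R κ Φ t p D mk g f WxY) : ℕ) : ℤ) - (KS.X1 κ Φ t p D mk g f (kgq κ Φ t p D g f 0))) ∧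
    ((kgRows0_of κ Φ t p D g f mk 0 0 hN hg).kgLastHi 30) 0 - ((((KS.X2R κ Φ t p D mk g f WxY) : ℕ) : ℤ) - (KS.X1 κ Φ t p D mk g f (kgq κ Φ t p D g f 0))) ≤ (((((nL κ Φ t p D g f) - (vL κ Φ t p D g f)).toNat + (kgWY κ Φ t p D g f (KS.WxYR κ Φ t p D mk g f WxY)) : ℕ)) : ℤ) ∧
    -((((kgqY κ Φ t p D g f qxY) : ℕ) : ℤ) * (shearUnit (nL κ Φ t p D g f) (hL κ Φ t p D g f) : ℤ)) ≤ ((kgRows0_of κ Φ t p D g f mk 0 0 hN hg).kgLastLo 30) 1 * (shearUnit (nL κ Φ t p D g f) (hL κ Φ t p D g f) : ℤ) -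
      (((nL κ Φ t p D g f : ℤ) * (KS.Y2R κ Φ t p D mk g f WxY) - (hL κ Φ t p D g f) * (((KS.X2R κ Φ t p D mk g f WxY) : ℕ) : ℤ)) - ((nL κ Φ t p D g f : ℤ) * (KS.Y1s κ Φ t p D mk g f (kgq κ Φ t p D g f 0)) - (hL κ Φ t p D g f) * (KS.X1 κ Φ t p D mk g f (kgq κ Φ t p D g f 0)))) ∧
    (((kgRows0_of κ Φ t p D g f mk 0 0 hN hg).kgLastHi 30) 1 + 1) * (shearUnit (nL κ Φ t p D g f) (hL κ Φ t p D g f) : ℤ) - (((nL κ Φ t p D g f : ℤ) * (KS.Y2R κ Φ t p D mk g f WxY) - (hL κ Φ t p D g f) * (((KS.X2R κ Φ t p D mk g f WxY) : ℕ) : ℤ)) - ((nL κ Φ t p D g f : ℤ) * (KS.Y1s κ Φ t p D mk g f (kgq κ Φ t p D g f 0)) - (hL κ Φ t p D g f) * (KS.X1 κ Φ t p D mk g f (kgq κ Φ t p D g f 0)))) ≤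
      ((((kgqY κ Φ t p D g f qxY) : ℕ) : ℤ) + 1) * (shearUnit (nL κ Φ t p D g f) (hL κ Φ t p D g f) : ℤ) := by
  obtain ⟨hXlo, hXhi⟩ := X1_bounds κ Φ t p D mk g f 0 hf
  push_cast at hXlo hXhi
  obtain ⟨hX0, hX12⟩ := XP_bounds κ Φ t p D mk g f hN hg hg2
  obtain ⟨hrlo, hrhi⟩ := lastP_rows κ Φ t p D mk g f hN hg hg2
  obtain ⟨hsum1, hsum⟩ := X2R_add_WxYR κ Φ t p D mk g f WxY hWxY
  obtain ⟨r2lo, r2hi, -⟩ := rows_c₂_zero κ Φ t p D mk g f WxY hN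
  obtain ⟨r1lo, r1hi, -⟩ := rows_c₁s_zero κ Φ t p D mk g f (kgq κ Φ t p D g f 0) hN
  obtain ⟨hKR, -, h958, -, hK, h8⟩ := valsQ_floor κ Φ t p D g f mk hN hg hg2
  have hv := hN.v_le
  have hvn : -(nL κ Φ t p D g f : ℤ) ≤ (vL κ Φ t p D g f) := by have := neg_abs_le (vL κ Φ t p D g f); linarith
  have hvp : (vL κ Φ t p D g f) ≤ (nL κ Φ t p D g f : ℤ) := by have := le_abs_self (vL κ Φ t p D g f); linarith
  have hn0 : (0 : ℤ) ≤ (nL κ Φ t p D g f : ℤ) := by positivity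
  have hU : (nL κ Φ t p D g f : ℤ) ≤ (shearUnit (nL κ Φ t p D g f) (hL κ Φ t p D g f) : ℤ) := by
    unfold Skelφ.shearUnit; push_cast
    have : (((hL κ Φ t p D g f)).natAbs : ℤ) = |(hL κ Φ t p D g f)| := Int.natCast_natAbs _
    have := abs_nonneg (hL κ Φ t p D g f); linarith
  have hU0 : (0 : ℤ) ≤ (shearUnit (nL κ Φ t p D g f) (hL κ Φ t p D g f) : ℤ) := by linarith
  have hX2up : 2 * (((KS.X2R κ Φ t p D mk g f WxY) : ℕ) : ℤ) ≤ (WxY : ℤ) + ((KS.Rs t D mk : ℕ) : ℤ) + 34 * (nL κ Φ t p D g f : ℤ) + 29 * (((KS0.R'0 κ Φ t p D mk) : ℕ) : ℤ) + 2 := by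
    have : 2 * (KS.X2R κ Φ t p D mk g f WxY) ≤ WxY + KS.Rs t D mk + 34 * (nL κ Φ t p D g f) + 29 * (KS0.R'0 κ Φ t p D mk) + 2 := by unfold KS.X2R; omega
    exact_mod_cast this
  have hWR : (((kgWY κ Φ t p D g f (KS.WxYR κ Φ t p D mk g f WxY)) : ℕ) : ℤ) + (KS.X2R κ Φ t p D mk g f WxY) = 2 * (nL κ Φ t p D g f : ℤ) + WxY := by
    rw [hsum]; unfold kgWY; push_cast; ring
  have hWx45' : 45 * (nL κ Φ t p D g f : ℤ) ≤ (WxY : ℤ) := by exact_mod_cast hWx45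
  have h1600 : 1600 * (((KS0.R'0 κ Φ t p D mk) : ℕ) : ℤ) + 1 ≤ (nL κ Φ t p D g f : ℤ) := by nlinarith
  have ht1 : (0 : ℤ) ≤ ((((nL κ Φ t p D g f) + (vL κ Φ t p D g f)).toNat : ℕ) : ℤ) := by positivity
  have ht2 : (0 : ℤ) ≤ ((((nL κ Φ t p D g f) - (vL κ Φ t p D g f)).toNat : ℕ) : ℤ) := by positivity
  have hq : (((kgqY κ Φ t p D g f qxY) : ℕ) : ℤ) = (((nL κ Φ t p D g f) * (ℓL κ Φ t p D g f) / shearUnit (nL κ Φ t p D g f) (hL κ Φ t p D g f) + 1 : ℕ) : ℤ) + qxY := by unfold kgqY; push_cast; ring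
  have hP0 : (0 : ℤ) ≤ (((nL κ Φ t p D g f) * (ℓL κ Φ t p D g f) / shearUnit (nL κ Φ t p D g f) (hL κ Φ t p D g f) + 1 : ℕ) : ℤ) := by positivity
  have hs0 : 0 ≤ (kgSL (nL κ Φ t p D g f) (ℓL κ Φ t p D g f) (hL κ Φ t p D g f)) := by linarith
  have hP0' : (0 : ℤ) ≤ ((nL κ Φ t p D g f : ℤ)) * (((ℓL κ Φ t p D g f) : ℕ) : ℤ) / (shearUnit (nL κ Φ t p D g f) (hL κ Φ t p D g f) : ℤ) := Int.ediv_nonneg (by positivity) hU0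
  -- the along coordinates of the prefix's arrival box
  have e0 : ((kgRows0_of κ Φ t p D g f mk 0 0 hN hg).kgLastLo 30) 0 = ((30 : ℕ) + 1 : ℤ) * (nL κ Φ t p D g f : ℤ) + (kgX (nL κ Φ t p D g f) (ℓL κ Φ t p D g f) (hL κ Φ t p D g f) (vL κ Φ t p D g f) (kgR κ Φ t p D mk) 0 (kgq κ Φ t p D g f 0) (kgW κ Φ t p D g f 0) 30) - ((nL κ Φ t p D g f : ℤ) + ((0 : ℕ) : ℤ) - 1) := by
    simp only [KGRows.kgLastLo, Matrix.cons_val_zero]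
  have e1 : ((kgRows0_of κ Φ t p D g f mk 0 0 hN hg).kgLastHi 30) 0 = ((30 : ℕ) + 1 : ℤ) * (nL κ Φ t p D g f : ℤ) + (kgX (nL κ Φ t p D g f) (ℓL κ Φ t p D g f) (hL κ Φ t p D g f) (vL κ Φ t p D g f) (kgR κ Φ t p D mk) 0 (kgq κ Φ t p D g f 0) (kgW κ Φ t p D g f 0) 30) := by
    simp only [KGRows.kgLastHi, Matrix.cons_val_zero]
  refine ⟨?_, ?_, ?_, ?_⟩
  · rw [e0]; push_cast; linarith
  · rw [e1]; push_cast; linarith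
  · have h1 : -((kgSL (nL κ Φ t p D g f) (ℓL κ Φ t p D g f) (hL κ Φ t p D g f)) + 2) * (shearUnit (nL κ Φ t p D g f) (hL κ Φ t p D g f) : ℤ) ≤ ((kgRows0_of κ Φ t p D g f mk 0 0 hN hg).kgLastLo 30) 1 * (shearUnit (nL κ Φ t p D g f) (hL κ Φ t p D g f) : ℤ) := mul_le_mul_of_nonneg_right hrlo hU0
    have h2 : ((kgSL (nL κ Φ t p D g f) (ℓL κ Φ t p D g f) (hL κ Φ t p D g f)) + 2 + 1) * (shearUnit (nL κ Φ t p D g f) (hL κ Φ t p D g f) : ℤ) ≤ (((kgqY κ Φ t p D g f qxY) : ℕ) : ℤ) * (shearUnit (nL κ Φ t p D g f) (hL κ Φ t p D g f) : ℤ) := mul_le_mul_of_nonneg_right (by rw [hq]; push_cast; linarith) hU0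
    linarith
  · have h1 : (((kgRows0_of κ Φ t p D g f mk 0 0 hN hg).kgLastHi 30) 1 + 1) * (shearUnit (nL κ Φ t p D g f) (hL κ Φ t p D g f) : ℤ) ≤ (3 * (kgSL (nL κ Φ t p D g f) (ℓL κ Φ t p D g f) (hL κ Φ t p D g f)) + 1) * (shearUnit (nL κ Φ t p D g f) (hL κ Φ t p D g f) : ℤ) := mul_le_mul_of_nonneg_right (by linarith) hU0
    have h2 : (3 * (kgSL (nL κ Φ t p D g f) (ℓL κ Φ t p D g f) (hL κ Φ t p D g f)) + 2) * (shearUnit (nL κ Φ t p D g f) (hL κ Φ t p D g f) : ℤ) ≤ ((((kgqY κ Φ t p D g f qxY) : ℕ) : ℤ) + 1) * (shearUnit (nL κ Φ t p D g f) (hL κ Φ t p D g f) : ℤ) := mul_le_mul_of_nonneg_right (by rw [hq]; push_cast; linarith) hU0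
    linarith

/-- **THE SKELETON'S `hx₂` AT THE (R-46)/(R-47) VALUES**: for any planar map `ψ` and vertices `c₁* = t + (X1, Y1s)`, `c₂ = t + (X2R, Y2R)` (exact
offsets), every `w` whose `c₁*`-frame position lies in the prefix's last core has its `c₂`-frame position in core `0` of the root's y′-corridor. [this work] -/
theorem hx₂_R (κ : Consts) {V : Type} [DecidableEq V] [Countable V] {G : SimpleGraph V} [G.LocallyFinite] (Φ : PlanarSkeletonFrmFrom G) (t : V) (p : unitInterval) (D : Skelφ.StepI.DataNS V) (mk : ℕ) (g : ℕ) (f : ℕ) (qxY : ℕ) (WxY : ℕ) (hN : EqNumL κ Φ t p D g f) (hg : gFloorKG κ Φ t p D mk ≤ g) (hg2 : 40 * Neg.K κ * KS0.R'0 κ Φ t p D mk ≤ g)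
    (hf : KS.fxR0 κ Φ t p D mk ≤ f) (hWxY : KS.Rs t D mk + 34 * nL κ Φ t p D g f + 29 * KS0.R'0 κ Φ t p D mk + 2 ≤ WxY)
    (hWx45 : 45 * nL κ Φ t p D g f ≤ WxY) (hq3 : 3 * (kgSL (nL κ Φ t p D g f) (ℓL κ Φ t p D g f) (hL κ Φ t p D g f)) ≤ (qxY : ℤ))
    {ψ : V → Site 2} {c₁ c₂ : V} (hX1 : ψ c₁ 0 - ψ t 0 = (KS.X1 κ Φ t p D mk g f (kgq κ Φ t p D g f 0))) (hY1 : ψ c₁ 1 - ψ t 1 = (KS.Y1s κ Φ t p D mk g f (kgq κ Φ t p D g f 0)))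
    (hX2 : ψ c₂ 0 - ψ t 0 = (((KS.X2R κ Φ t p D mk g f WxY) : ℕ) : ℤ)) (hY2 : ψ c₂ 1 - ψ t 1 = (KS.Y2R κ Φ t p D mk g f WxY)) {w : V}
    (hw : Skelφ.runX ψ c₁ (nL κ Φ t p D g f) (hL κ Φ t p D g f) 1 w ∈ ScheduleNP.core (Skelφ.kgCorrSched ((kgRows0_of κ Φ t p D g f mk 0 0 hN hg).kgVals_ok₁ 30) ((kgRows0_of κ Φ t p D g f mk 0 0 hN hg).kgVals_ok₂ 30) ((kgRows0_of κ Φ t p D g f mk 0 0 hN hg).kgVals_split 30)) ((Skelφ.kgCorrSched ((kgRows0_of κ Φ t p D g f mk 0 0 hN hg).kgVals_ok₁ 30) ((kgRows0_of κ Φ t p D g f mk 0 0 hN hg).kgVals_ok₂ 30) ((kgRows0_of κ Φ t p D g f mk 0 0 hN hg).kgVals_split 30)).N + 1)) :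
    Skelφ.runX ψ c₂ (nL κ Φ t p D g f) (hL κ Φ t p D g f) 1 w ∈ ScheduleNP.core (Skelφ.kgCorrSchedY (kgYRows0_of κ Φ t p D g f mk qxY (KS.WxYR κ Φ t p D mk g f WxY) hN hg).hn (kgYRows0_of κ Φ t p D g f mk qxY (KS.WxYR κ Φ t p D mk g f WxY) hN hg).hv (kgYRows0_of κ Φ t p D g f mk qxY (KS.WxYR κ Φ t p D mk g f WxY) hN hg).hlay ((kgYRows0_of κ Φ t p D g f mk qxY (KS.WxYR κ Φ t p D mk g f WxY) hN hg).kgYVals_ok₁ (kgNYv0 κ Φ t p D g f mk qxY WxY)) ((kgYRows0_of κ Φ t p D g f mk qxY (KS.WxYR κ Φ t p D mk g f WxY) hN hg).kgYVals_ok₂ (kgNYv0 κ Φ t p D g f mk qxY WxY)) ((kgYRows0_of κ Φ t p D g f mk qxY (KS.WxYR κ Φ t p D mk g f WxY) hN hg).kgYVals_split (kgNYv0 κ Φ t p D g f mk qxY WxY))) 0 := by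
  obtain ⟨hx0, hx1, hr₁, hr₂⟩ := hx₂_rows_R κ Φ t p D mk g f qxY WxY hN hg hg2 hf hWxY hWx45 hq3
  have hw' := (kgRows0_of κ Φ t p D g f mk 0 0 hN hg).mem_Icc_of_mem_last 30 hw
  have hX : ψ c₂ 0 - ψ c₁ 0 = (((KS.X2R κ Φ t p D mk g f WxY) : ℕ) : ℤ) - (KS.X1 κ Φ t p D mk g f (kgq κ Φ t p D g f 0)) := by linarith
  have hS : (nL κ Φ t p D g f : ℤ) * (ψ c₂ 1 - ψ c₁ 1) - (hL κ Φ t p D g f) * (ψ c₂ 0 - ψ c₁ 0) =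
      ((nL κ Φ t p D g f : ℤ) * (KS.Y2R κ Φ t p D mk g f WxY) - (hL κ Φ t p D g f) * (((KS.X2R κ Φ t p D mk g f WxY) : ℕ) : ℤ)) - ((nL κ Φ t p D g f : ℤ) * (KS.Y1s κ Φ t p D mk g f (kgq κ Φ t p D g f 0)) - (hL κ Φ t p D g f) * (KS.X1 κ Φ t p D mk g f (kgq κ Φ t p D g f 0))) := by
    have e1 : ψ c₂ 1 - ψ c₁ 1 = (KS.Y2R κ Φ t p D mk g f WxY) - (KS.Y1s κ Φ t p D mk g f (kgq κ Φ t p D g f 0)) := by linarith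
    rw [e1, hX]; ring
  exact Skelφ.runX_mem_kgCorrSchedY_core_zero_of_runX (kgYRows0_of κ Φ t p D g f mk qxY (KS.WxYR κ Φ t p D mk g f WxY) hN hg).hn (kgYRows0_of κ Φ t p D g f mk qxY (KS.WxYR κ Φ t p D mk g f WxY) hN hg).hv (kgYRows0_of κ Φ t p D g f mk qxY (KS.WxYR κ Φ t p D mk g f WxY) hN hg).hlay ((kgYRows0_of κ Φ t p D g f mk qxY (KS.WxYR κ Φ t p D mk g f WxY) hN hg).kgYVals_ok₁ (kgNYv0 κ Φ t p D g f mk qxY WxY)) ((kgYRows0_of κ Φ t p D g f mk qxY (KS.WxYR κ Φ t p D mk g f WxY) hN hg).kgYVals_ok₂ (kgNYv0 κ Φ t p D g f mk qxY WxY))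
    ((kgYRows0_of κ Φ t p D g f mk qxY (KS.WxYR κ Φ t p D mk g f WxY) hN hg).kgYVals_split (kgNYv0 κ Φ t p D g f mk qxY WxY)) c₁ c₂ hX hS hx0 hx1 hr₁ hr₂ hw'

end CrossY

end KS

end NegB

end PlanarSkeletonFrmFrom

end Summit.CriticalPhenomena.PercolationContinuityZ3.Theorems.Transplant

end
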